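import Mathlib
import Literature.Analysis.FluidPDE.Tao2016AveragedNS.ShiftSetCascadeFlows
import Summits.NavierStokesRegularity.NavierStokesRegularity.Theorems.TaoLadderRungTwoFlatMirrorField
import Summits.NavierStokesRegularity.NavierStokesRegularity.Theorems.TaoLadderRungTwoFlatCertificateGlueFieldBoundsOn
import HarnessLib

/-!
# Certificate glue on a shift set `𝕊`, XV-b: CLOSED-FORM (B)-TABLE of the mirror-seeded Toda table `mirrorTable ½ ½` on `S♭`
  (helper for item stmt-NavierStokesRegularity-22987 `FlatGapCertificatesV2`; cell harvest/h2-tao-ladder, p1 g14)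

The bilinear-bound table of glue XVI/XVII/XIX (`Σ_{i₁,i₂,μ} |α i₁ i₂ i μ| (1+ε₀)^{5(k−μ₃)/2} ω̂_a ω̂_b ≤ b ω_k`) in CLOSED
FORM for `mirrorTable (1/2) (1/2)`: per window shell `k`, with `c_k = (1+ε₀)^{5k/2}` and `ω̂ = wExt` (zero off the window),
* carrier (`i = 0`): `(3/2) c_k ω̂_k² + c_{k-1} (ω̂_{k-1}² + ½ ω̂_k ω̂_{k-1})`,
* bond    (`i = 1`): `c_k ((3/2) ω̂_k² + ω̂_k ω̂_{k+1} + ½ ω̂_{k+1}²)`,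
so the constant `b` of the certificate is `max_k` of these two numbers divided by `ω_k` — two short formulas for the
assembler / checker (CHECKER-SPEC C1).

HONEST FRAMING: identities about the structure table of a MODEL lattice; nothing certified, no stub closed, nothing about
the Navier–Stokes equations.
-/

noncomputable section

-- the sub-problem namespace repeats the summit name by design (D-0017)
set_option linter.dupNamespace false

namespace Summit.NavierStokesRegularity.NavierStokesRegularity.Theorems

open Finset Literature.Analysis.FluidPDE Literature.Analysis.FluidPDE.TaoCascade
open Summit.NavierStokesRegularity.NavierStokesRegularity.Theorems.MirrorField

namespace CertificateGlueOn

/-- **(B)-table, carrier row** of `mirrorTable ½ ½` on `S♭` in closed form. [cite: Tao2016AveragedNS, §4 (4.1) (structure constants); route TaoLadderRungTwoFlat, posited table] -/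
theorem btable_mirrorHalf_carrier (ε₀ : ℝ) (Kb Ka : ℤ) (ω : ℤ → ℝ) (k : ℤ) :
    ∑ i₁ : Fin 2, ∑ i₂ : Fin 2, ∑ μ ∈ shiftSetFlat,
        |mirrorTable (1 / 2) (1 / 2) i₁ i₂ 0 μ| * (1 + ε₀) ^ ((5 : ℝ) * (k - μ.2.2) / 2) *
          (wExt Kb Ka ω (k - μ.2.2 + μ.1) * wExt Kb Ka ω (k - μ.2.2 + μ.2.1)) =
      (1 + ε₀) ^ ((5 : ℝ) * (k - (0 : ℤ)) / 2) * ((3 / 2) * wExt Kb Ka ω k ^ 2) +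
        (1 + ε₀) ^ ((5 : ℝ) * (k - (1 : ℤ)) / 2) *
          (wExt Kb Ka ω (k - 1) ^ 2 + (1 / 2) * (wExt Kb Ka ω k * wExt Kb Ka ω (k - 1))) := by
  simp only [Fin.sum_univ_two, sum_shiftSetFlat, mirrorTable]
  norm_num
  ring

/-- **(B)-table, bond row** of `mirrorTable ½ ½` on `S♭` in closed form. [cite: Tao2016AveragedNS, §4 (4.1) (structure constants); route TaoLadderRungTwoFlat, posited table] -/
theorem btable_mirrorHalf_bond (ε₀ : ℝ) (Kb Ka : ℤ) (ω : ℤ → ℝ) (k : ℤ) :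
    ∑ i₁ : Fin 2, ∑ i₂ : Fin 2, ∑ μ ∈ shiftSetFlat,
        |mirrorTable (1 / 2) (1 / 2) i₁ i₂ 1 μ| * (1 + ε₀) ^ ((5 : ℝ) * (k - μ.2.2) / 2) *
          (wExt Kb Ka ω (k - μ.2.2 + μ.1) * wExt Kb Ka ω (k - μ.2.2 + μ.2.1)) =
      (1 + ε₀) ^ ((5 : ℝ) * (k - (0 : ℤ)) / 2) *
        ((3 / 2) * wExt Kb Ka ω k ^ 2 + wExt Kb Ka ω k * wExt Kb Ka ω (k + 1) +
          (1 / 2) * wExt Kb Ka ω (k + 1) ^ 2) := by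
  simp only [Fin.sum_univ_two, sum_shiftSetFlat, mirrorTable]
  norm_num
  ring

end CertificateGlueOn

end Summit.NavierStokesRegularity.NavierStokesRegularity.Theorems

end
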